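import Mathlib.Data.Nat.Choose.Bounds
import Summits.ValiantsHypothesis.ValiantsHypothesis.Theorems.LacunarySymmetroidMatrixDescartesCensusTropicalKLawSlopes

/-!
# `TropicalB` — small-format partial ranges of the two regime stubs (counting rungs)

HONEST FRAMING.  Helper toward the crux `Summit.ValiantsHypothesis.ValiantsHypothesis.Theses.KPlusLogSqLaw.TropicalB`
(ledger item `stmt-ValiantsHypothesis-19771`, route `KPlusLogSqLaw`; object-search cell `pub-symmetroid`, prover seat
val-sym-trop-p3, 2026-08-26), toward its two registered regime stubs of `Cruxes/TropicalB/Lines/birth.lean`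

* `stub_tropThin : ∃ C, ∀ m K, K ≤ log₂² m → TropRow m K (2 ^ (C·log₂² m))`,
* `stub_tropFat  : ∃ C, ∀ m K, log₂² m ≤ K → TropRow m K (2 ^ (C·K))`

(`TropRow m K B` is δ-equal to the tree row `TropRootLawAt m K B`).  Everything here is COUNTING (the slope-class law
`tropRootLawAt_slopeCount`: `T(m,K) ≤ multichoose K m − 1`), so every statement sits inside Conjecture B's Descartes-known
regime; nothing is claimed about the stubs inside the window `log₂ m + 1 < K < m`, about `TropicalB`, `KPlusLogSqLaw`,
`MatrixDescartes` or `VP ≠ VNP`.  What is proved: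

1. STARS AND BARS `multichoose_le_succ_pow : multichoose K m ≤ (m+1)^(K−1)` and the fixed-`K` POLYNOMIAL row
   `tropRootLawAt_poly : TropRootLawAt m K ((m+1)^(K−1) − 1)`; in particular the tree candidate `TropK4Law 3`
   (`…CensusTropicalKLaw`, "holds by count vectors, not formalised") is discharged: `tropK4Law_three`.
2. SMALL SIZES `m ≤ 4`, all `K`: the window is empty (`offWindow_of_le_four`), and both stub conclusions hold verbatim with
   `C = 2` (`tropThin_of_le_four`, `tropFatShape_of_le_four` — the latter for every `K`).
3. FEW CLASSES: `K ≤ K₀ → K ≤ log₂² m → TropRootLawAt m K (2 ^ (K₀ · log₂² m))` (`tropThin_of_K_le`, one constant per `K₀`;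
   `K₀ = 4` is the docket case), and the fat stub verbatim with `C = 2` for `K ≤ 8` (`tropFat_of_K_le_eight`: the regime
   forces `m ≤ 7`, finitely many formats; at `K = 9` counting with `C = 2` first fails, at `(m, K) = (14, 9)` and `(15, 9)`).
4. FAT CONE in stub shape: `m ≤ B·K → TropRootLawAt m K (2 ^ ((B+1)·K))` (`tropFat_cone`; one constant per `B`, so a
   support of `stub_tropFat`, not the stub — its `∃ C` is outermost).

[folklore] stars and bars; the rest is arithmetic on the cell's slope-counting law.
-/

-- `Summit.ValiantsHypothesis.ValiantsHypothesis.…` repeats a component by the D-0017 layout (single-conjunct summit),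
-- which the `dupNamespace` linter flags; the namespace is mandated (same as the sibling `…TropicalKLaw*` modules).
set_option linter.dupNamespace false
set_option autoImplicit false

namespace Summit.ValiantsHypothesis.ValiantsHypothesis.Theorems.LacunarySymmetroidMatrixDescartes.TropicalCensus

open Finset

/-! ## 1. Stars and bars and the fixed-`K` polynomial row -/

/-- Stars and bars, successor form: `multichoose (K+1) m ≤ (m+1)^K` — a multiset of size `m` over `K+1` classes is
determined by the multiplicities of its first `K` classes, each in `[0, m]`. [folklore] -/
theorem multichoose_succ_le_succ_pow (K : ℕ) : ∀ m : ℕ, Nat.multichoose (K + 1) m ≤ (m + 1) ^ K := by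
  induction K with
  | zero => intro m; simp [Nat.multichoose_one]
  | succ K ih =>
    intro m
    induction m with
    | zero => simp [Nat.multichoose_zero_right]
    | succ m ihm =>
      rw [Nat.multichoose_succ_succ]
      have h1 : Nat.multichoose (K + 1) (m + 1) ≤ (m + 2) ^ K := ih (m + 1)
      have h2 : (m + 1) ^ K ≤ (m + 2) ^ K := Nat.pow_le_pow_left (by omega) K
      calc Nat.multichoose (K + 1) (m + 1) + Nat.multichoose (K + 1 + 1) m
          ≤ (m + 2) ^ K + (m + 1) ^ (K + 1) := Nat.add_le_add h1 ihm
        _ = (m + 2) ^ K + (m + 1) ^ K * (m + 1) := by rw [pow_succ]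
        _ ≤ (m + 2) ^ K + (m + 2) ^ K * (m + 1) := by nlinarith
        _ = (m + 1 + 1) ^ (K + 1) := by ring

/-- Stars and bars: `multichoose K m ≤ (m+1)^(K−1)` (for `K = 0` both conventions give `≤ 1`). [folklore] -/
theorem multichoose_le_succ_pow (K m : ℕ) : Nat.multichoose K m ≤ (m + 1) ^ (K - 1) := by
  rcases K with _ | K
  · rcases m with _ | m
    · simp [Nat.multichoose_zero_right]
    · simp [Nat.multichoose_zero_succ]
  · simpa using multichoose_succ_le_succ_pow K m

/-- **Fixed-`K` polynomial row** (counting): `T(m,K) ≤ (m+1)^(K−1) − 1`, i.e. `TropRootLawAt m K ((m+1)^(K−1) − 1)` — the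
slope-class law `tropRootLawAt_slopeCount` with stars and bars. [folklore] -/
theorem tropRootLawAt_poly (m K : ℕ) : TropRootLawAt m K ((m + 1) ^ (K - 1) - 1) :=
  tropRootLawAt_mono (Nat.sub_le_sub_right (multichoose_le_succ_pow K m) 1) (tropRootLawAt_slopeCount m K)

/-- **`TropK4Law 3` holds** (the tree candidate of `…CensusTropicalKLaw`, "holds by count vectors, not formalised"):
`T(m,4) ≤ (m+1)^3` with `C = 1`.  The open calibration question of the cell is `TropK4Law 2`; nothing is said about it.
[folklore] -/
theorem tropK4Law_three : TropK4Law 3 :=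
  ⟨1, fun m => tropRootLawAt_mono (by rw [one_mul]; exact Nat.sub_le _ _) (tropRootLawAt_poly m 4)⟩

/-! ## 2. Small sizes `m ≤ 4`: the window `log₂ m + 1 < K < m` is empty -/

/-- For `2 ≤ m` we have `1 ≤ log₂ m`. [folklore] -/
theorem one_le_log_two (m : ℕ) (hm : 2 ≤ m) : 1 ≤ Nat.log 2 m :=
  Nat.le_log_of_pow_le (by norm_num) (by simpa using hm)

/-- For `4 ≤ m` we have `2 ≤ log₂ m`. [folklore] -/
theorem two_le_log_two (m : ℕ) (hm : 4 ≤ m) : 2 ≤ Nat.log 2 m :=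
  Nat.le_log_of_pow_le (by norm_num) (by simpa using hm)

/-- For `m ≤ 3` we have `log₂ m ≤ 1`, and for `m ≤ 7` we have `log₂ m ≤ 2`. [folklore] -/
theorem log_two_le_of_le (m : ℕ) : (m ≤ 3 → Nat.log 2 m ≤ 1) ∧ (m ≤ 7 → Nat.log 2 m ≤ 2) := by
  constructor
  · intro hm
    rcases Nat.eq_zero_or_pos m with rfl | hpos
    · simp
    · exact Nat.le_of_lt_succ (Nat.log_lt_of_lt_pow' (by norm_num) (by norm_num; omega))
  · intro hm
    rcases Nat.eq_zero_or_pos m with rfl | hpos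
    · simp
    · exact Nat.le_of_lt_succ (Nat.log_lt_of_lt_pow' (by norm_num) (by norm_num; omega))

/-- If `log₂ m ≤ 2` then `m ≤ 7`. [folklore] -/
theorem le_seven_of_log_two_le_two (m : ℕ) (h : Nat.log 2 m ≤ 2) : m ≤ 7 := by
  have := Nat.lt_pow_succ_log_self (b := 2) (by norm_num) m
  have h8 : 2 ^ (Nat.log 2 m).succ ≤ 2 ^ 3 := Nat.pow_le_pow_right (by norm_num) (by omega)
  omega

/-- With at most one slope class there is no sign alternation: `K ≤ 1 → TropRootLawAt m K 0`. [folklore] -/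
theorem tropRootLawAt_of_K_le_one (m K : ℕ) (hK : K ≤ 1) : TropRootLawAt m K 0 := by
  rcases Nat.eq_zero_or_pos K with rfl | hKpos
  · exact tropRootLawAt_zero m 0
  · obtain rfl : K = 1 := le_antisymm hK hKpos
    refine tropRootLawAt_mono ?_ (tropRootLawAt_slopeCount m 1)
    simp [Nat.multichoose_one]

/-- **The window is empty for `m ≤ 4`**: every format with `m ≤ 4` satisfies `K ≤ log₂ m + 1 ∨ m ≤ K`, so the off-window
law `tropRootLawAt_offWindow` (C = 3) covers it. [folklore] -/
theorem offWindow_of_le_four (m K : ℕ) (hm : m ≤ 4) : K ≤ Nat.log 2 m + 1 ∨ m ≤ K := by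
  rcases le_or_gt m K with h | h
  · exact Or.inr h
  · left
    -- `K < m ≤ 4`; show `m ≤ log₂ m + 2`
    rcases le_or_gt 4 m with h4 | h4
    · have := two_le_log_two m h4; omega
    · rcases le_or_gt 2 m with h2 | h2
      · have := one_le_log_two m h2; omega
      · omega

/-- **TB with `C = 3` at every format with `m ≤ 4`** (all `K`): corollary of the empty window. [folklore] -/
theorem tropRootLawAt_of_le_four (m K : ℕ) (hm : m ≤ 4) : TropRootLawAt m K (2 ^ (3 * (K + Nat.log 2 m ^ 2))) :=
  tropRootLawAt_offWindow m K (offWindow_of_le_four m K hm)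

/-- **`stub_tropFat`'s conclusion with `C = 2` at every format with `m ≤ 4`, for EVERY `K`** (no regime hypothesis is
needed): `m ≤ 4 → TropRootLawAt m K (2 ^ (2K))`.  For `m ≤ K` this is `tropRootLawAt_fatEnd`; for `K < m ≤ 4` the
polynomial row gives `≤ 5^(K−1) − 1 ≤ 4^K`. [folklore] -/
theorem tropFatShape_of_le_four (m K : ℕ) (hm : m ≤ 4) : TropRootLawAt m K (2 ^ (2 * K)) := by
  rcases le_or_gt m K with h | h
  · exact tropRootLawAt_fatEnd h
  · refine tropRootLawAt_mono ?_ (tropRootLawAt_poly m K)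
    have h5 : (m + 1) ^ (K - 1) ≤ 5 ^ (K - 1) := Nat.pow_le_pow_left (by omega) _
    have hK : K ≤ 3 := by omega
    interval_cases K <;> simp_all <;> omega

/-- **`stub_tropThin`'s conclusion with `C = 2` at every format with `m ≤ 4`**: `m ≤ 4 → K ≤ log₂² m →
TropRootLawAt m K (2 ^ (2·log₂² m))`.  (`m ≤ 3` forces `K ≤ 1`, no alternation; `m = 4` forces `K ≤ 4` and the polynomial
row gives `≤ 124 < 256`.) [folklore] -/
theorem tropThin_of_le_four (m K : ℕ) (hm : m ≤ 4) (hK : K ≤ Nat.log 2 m ^ 2) :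
    TropRootLawAt m K (2 ^ (2 * Nat.log 2 m ^ 2)) := by
  rcases le_or_gt m 3 with h3 | h3
  · -- `log₂ m ≤ 1`, so `K ≤ 1`
    have hL : Nat.log 2 m ≤ 1 := (log_two_le_of_le m).1 h3
    have hK1 : K ≤ 1 := hK.trans (by nlinarith)
    exact tropRootLawAt_mono (Nat.zero_le _) (tropRootLawAt_of_K_le_one m K hK1)
  · obtain rfl : m = 4 := le_antisymm hm h3
    have hL : Nat.log 2 4 = 2 := by
      have h1 := two_le_log_two 4 le_rfl
      have h2 := (log_two_le_of_le 4).2 (by norm_num)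
      omega
    rw [hL] at hK ⊢
    refine tropRootLawAt_mono ?_ (tropRootLawAt_poly 4 K)
    have hK4 : K ≤ 4 := by simpa using hK
    interval_cases K <;> norm_num

/-! ## 3. Few classes: `K ≤ K₀` -/

/-- **`stub_tropThin` restricted to `K ≤ K₀` holds with `C = K₀`**: `K ≤ K₀ → K ≤ log₂² m →
TropRootLawAt m K (2 ^ (K₀ · log₂² m))`.  Proof: `log₂ m ≤ 1` forces `K ≤ 1` (no alternation); otherwise
`(m+1)^(K−1) ≤ 2^((log₂ m + 1)(K₀ − 1)) ≤ 2^(K₀ log₂² m)`.  One constant per `K₀` — a partial range, not the stub. [folklore] -/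
theorem tropThin_of_K_le (K₀ m K : ℕ) (hKK₀ : K ≤ K₀) (hK : K ≤ Nat.log 2 m ^ 2) :
    TropRootLawAt m K (2 ^ (K₀ * Nat.log 2 m ^ 2)) := by
  set L := Nat.log 2 m with hL
  rcases le_or_gt L 1 with h1 | h1
  · have hK1 : K ≤ 1 := hK.trans (by nlinarith)
    exact tropRootLawAt_mono (Nat.zero_le _) (tropRootLawAt_of_K_le_one m K hK1)
  · refine tropRootLawAt_mono ?_ (tropRootLawAt_poly m K)
    have hm : m + 1 ≤ 2 ^ (L + 1) := hL ▸ Nat.lt_pow_succ_log_self (by norm_num) m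
    calc (m + 1) ^ (K - 1) - 1 ≤ (m + 1) ^ (K - 1) := Nat.sub_le _ _
      _ ≤ (2 ^ (L + 1)) ^ (K - 1) := Nat.pow_le_pow_left hm _
      _ = 2 ^ ((L + 1) * (K - 1)) := by rw [← pow_mul]
      _ ≤ 2 ^ (K₀ * L ^ 2) := Nat.pow_le_pow_right (by norm_num) ?_
    have h2 : K - 1 ≤ K₀ := by omega
    have h3 : L + 1 ≤ L ^ 2 := by nlinarith
    calc (L + 1) * (K - 1) ≤ L ^ 2 * K₀ := Nat.mul_le_mul h3 h2
      _ = K₀ * L ^ 2 := by ring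

/-- the docket case `K₀ = 4`: `K ≤ 4 → K ≤ log₂² m → TropRootLawAt m K (2 ^ (4 · log₂² m))`. [folklore] -/
theorem tropThin_of_K_le_four (m K : ℕ) (hK4 : K ≤ 4) (hK : K ≤ Nat.log 2 m ^ 2) :
    TropRootLawAt m K (2 ^ (4 * Nat.log 2 m ^ 2)) :=
  tropThin_of_K_le 4 m K hK4 hK

/-- counting table: for `m ≤ 7` and `K ≤ 8` the slope-class bound `C(K+m−1, m) − 1` is at most `4^K`. [folklore] -/
theorem choose_sub_one_le_four_pow_of_le (m K : ℕ) (hm : m ≤ 7) (hK : K ≤ 8) :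
    (K + m - 1).choose m - 1 ≤ 2 ^ (2 * K) := by
  interval_cases m <;> interval_cases K <;> decide

/-- **`stub_tropFat` restricted to `K ≤ 8` holds with `C = 2`**: `K ≤ 8 → log₂² m ≤ K → TropRootLawAt m K (2 ^ (2K))`.
The regime forces `log₂ m ≤ 2`, i.e. `m ≤ 7`: finitely many formats, each inside `4^K` by the slope-class count
(`choose_sub_one_le_four_pow_of_le`).  At `K = 9` this fails by counting alone (`(m, K) = (14, 9)`:
`C(22, 8) − 1 = 319769 > 2^18`; also `(15, 9)`: `C(23, 8) − 1 = 490313`), so `K ≤ 8` is the honest boundary of the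
`C = 2` counting range. [folklore] -/
theorem tropFat_of_K_le_eight (m K : ℕ) (hK8 : K ≤ 8) (hK : Nat.log 2 m ^ 2 ≤ K) :
    TropRootLawAt m K (2 ^ (2 * K)) := by
  have hL : Nat.log 2 m ≤ 2 := by nlinarith
  have hm : m ≤ 7 := le_seven_of_log_two_le_two m hL
  exact tropRootLawAt_mono (choose_sub_one_le_four_pow_of_le m K hm hK8) (tropRootLawAt_choose m K)

/-- the docket case `K ≤ 4` of the previous theorem. [folklore] -/
theorem tropFat_of_K_le_four (m K : ℕ) (hK4 : K ≤ 4) (hK : Nat.log 2 m ^ 2 ≤ K) :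
    TropRootLawAt m K (2 ^ (2 * K)) :=
  tropFat_of_K_le_eight m K (by omega) hK

/-! ## 4. The fat cone `m ≤ B·K` -/

/-- **Fat cone in stub shape** (counting): `m ≤ B·K → TropRootLawAt m K (2 ^ ((B+1)·K))`, from
`C(K+m−1, m) ≤ 2^(K+m−1)`.  `B = 1` is `tropRootLawAt_fatEnd`; one constant per `B`, so for `stub_tropFat` (whose `∃ C` is
outermost) this is a support covering the cone `K ≥ m / B`, not the stub: the open part of the fat regime is
`log₂² m ≤ K = o(m)`. [folklore] -/
theorem tropFat_cone (B m K : ℕ) (h : m ≤ B * K) : TropRootLawAt m K (2 ^ ((B + 1) * K)) := by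
  refine tropRootLawAt_mono ?_ (tropRootLawAt_choose m K)
  calc (K + m - 1).choose m - 1 ≤ (K + m - 1).choose m := Nat.sub_le _ _
    _ ≤ 2 ^ (K + m - 1) := Nat.choose_le_two_pow _ _
    _ ≤ 2 ^ ((B + 1) * K) := Nat.pow_le_pow_right (by norm_num) (by
        set N := B * K with hN
        have e : (B + 1) * K = N + K := by rw [hN]; ring
        omega)

end Summit.ValiantsHypothesis.ValiantsHypothesis.Theorems.LacunarySymmetroidMatrixDescartes.TropicalCensus
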